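import Mathlib
import HarnessLib
import Literature.Analysis.FluidPDE.ClassicalSolution
import Literature.Analysis.FluidPDE.WholeSpaceIBP
import Literature.Analysis.FluidPDE.HessianLaplacian
import Literature.Analysis.FluidPDE.SpaceTimeCalculus
import Literature.Analysis.FluidPDE.DriftDiffusionMaxPrinciple

/-!
# `ImplosionDoor.PassiveRadialVorticity` (stmt-NavierStokesRegularity-25305) — FAR-PAST WASHOUT OF A PASSIVE
# SCALAR OF LINEAR GROWTH UNDER A SPHERE-TANGENTIAL DRIFT (helper 2/2 for the research stub `stub_farPastWashout`)

**Theorem (`abs_mul_weight_le`).**  Let `χ : (−∞,0) × ℝ³ → ℝ` be jointly smooth and solve the drift–heat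
equation `∂ₜχ = Δχ − v·∇χ` classically, with a drift `v` that is SPHERE-TANGENTIAL (`⟪v(t,y), y⟫ = 0`; no
size or regularity condition), and let `|χ(t,y)| ≤ C′|y|/(−t)`.  Then for every `t₀ < 0`, `y₀` and every
`S > −t₀`:

  `|χ(t₀,y₀)| · (S − t₀)² e^{−|y₀|²/(4(S−t₀))} ≤ 4 C′ S √(2S)`.

Letting `S → ∞` gives `χ(t₀,y₀) = 0` (done in the stub file).

PROOF — Friedman's weak maximum principle on the whole space (tree THEOREM
`Literature.Analysis.FluidPDE.norm_le_of_inner_timeDeriv_le`, `DriftDiffusionMaxPrinciple`: ARBITRARY drift,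
subsolutions decaying at spatial infinity uniformly in time) applied on `[s, t₀]`, `s = −S`, to the GAUSSIAN GAUGE

  `ζ = χ · g`,  `g(t,y) = (S−t)² e^{−|y|²/(4(S−t))}`   (time-shifted to `[0, t₀ + S]`).

Since `g` is radial and `v` tangential, `v·∇g = 0`, and a three-line computation (`weight` lemmas below) gives
EXACTLY  `∂ₜζ = Δζ − U·∇ζ − ζ/(2(S−t))`  with the modified drift `U = v − y/(S−t)`; so `ζ ∂ₜζ ≤ ζ(Δζ − U·∇ζ)`,
`ζ` decays at infinity uniformly on `[s,t₀]` (Gaussian × linear growth), and the principle bounds `|ζ(t₀,y₀)|` by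
`sup|ζ(s,·)| ≤ (C′/S)(2S)² sup_r r e^{−r²/(8S)} ≤ 4C′S√(2S)` (no quadratic-growth comparison principle is needed).

HONEST FRAMING: a linear parabolic lemma used on HYPOTHETICAL blow-up profiles; nothing here bears on
Navier–Stokes regularity; no summit statement is proved.
-/

noncomputable section

-- the summit and its single sub-problem share the name (CONVENTIONS §1), as in every Theorems file
set_option linter.dupNamespace false

namespace Summit.NavierStokesRegularity.NavierStokesRegularity.Theorems.ImplosionDoorPassiveRadialVorticityWashout

open Set Function Metric
open scoped RealInnerProductSpace InnerProductSpace Topology Laplacian ContDiff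
open Literature.Analysis Literature.Analysis.FluidPDE

/-! ### The Gaussian gauge `g(t,y) = (a − t)² e^{−|y|²/(4(a−t))}` -/

/-- Joint smoothness of the gauge on `t < a`. [folklore] -/
theorem isSmoothSpaceTimeOn_weight (a : ℝ) :
    IsSmoothSpaceTimeOn (Iio a) fun t (y : EuclideanSpace ℝ (Fin 3)) =>
      (a - t) ^ 2 * Real.exp (-(‖y‖ ^ 2 / (4 * (a - t)))) := by
  have h1 : ContDiffOn ℝ ∞ (fun p : ℝ × EuclideanSpace ℝ (Fin 3) => (a - p.1) ^ 2) (Iio a ×ˢ univ) :=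
    ((contDiff_const.sub contDiff_fst).pow 2).contDiffOn
  have h2 : ContDiffOn ℝ ∞ (fun p : ℝ × EuclideanSpace ℝ (Fin 3) => -(‖p.2‖ ^ 2 / (4 * (a - p.1))))
      (Iio a ×ˢ univ) := by
    refine ContDiffOn.neg (ContDiffOn.div ?_ ?_ ?_)
    · exact ((contDiff_norm_sq ℝ).comp contDiff_snd).contDiffOn
    · exact (contDiff_const.mul (contDiff_const.sub contDiff_fst)).contDiffOn
    · intro p hp
      have : p.1 < a := (mem_prod.1 hp).1
      have : 0 < a - p.1 := sub_pos.2 this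
      positivity
  exact h1.mul (h2.exp)

/-- Slices of the gauge are smooth. [folklore] -/
theorem contDiff_weight_slice (a t : ℝ) :
    ContDiff ℝ 2 fun y : EuclideanSpace ℝ (Fin 3) => (a - t) ^ 2 * Real.exp (-(‖y‖ ^ 2 / (4 * (a - t)))) :=
  contDiff_const.mul ((((contDiff_norm_sq ℝ).div_const _).neg).exp)

/-- Spatial derivative of the gauge: `Dg(y) h = −(g(y)/(2(a−t))) ⟪y, h⟫`. [folklore] -/
theorem hasFDerivAt_weight_slice {a t : ℝ} (ht : t < a) (y : EuclideanSpace ℝ (Fin 3)) :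
    HasFDerivAt (fun y : EuclideanSpace ℝ (Fin 3) => (a - t) ^ 2 * Real.exp (-(‖y‖ ^ 2 / (4 * (a - t)))))
      ((-((a - t) ^ 2 * Real.exp (-(‖y‖ ^ 2 / (4 * (a - t)))) / (2 * (a - t)))) • innerSL ℝ y) y := by
  have hσ : 0 < a - t := sub_pos.2 ht
  have hN : HasFDerivAt (fun z : EuclideanSpace ℝ (Fin 3) => ‖z‖ ^ 2) (2 • innerSL ℝ y) y :=
    (hasStrictFDerivAt_norm_sq y).hasFDerivAt
  have h1 : HasFDerivAt (fun z : EuclideanSpace ℝ (Fin 3) => -(‖z‖ ^ 2 / (4 * (a - t))))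
      ((-(1 / (4 * (a - t)))) • (2 • innerSL ℝ y)) y := by
    have h := hN.const_mul (-(1 / (4 * (a - t))))
    have hfun : (fun z : EuclideanSpace ℝ (Fin 3) => -(1 / (4 * (a - t))) * ‖z‖ ^ 2) =
        fun z => -(‖z‖ ^ 2 / (4 * (a - t))) := by
      funext z; ring
    rw [hfun] at h
    exact h
  have h3 := (h1.exp).const_mul ((a - t) ^ 2)
  refine h3.congr_fderiv (ContinuousLinearMap.ext fun h => ?_)
  simp only [smul_apply, innerSL_apply_apply, smul_eq_mul, nsmul_eq_mul, Nat.cast_ofNat]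
  field_simp
  ring

/-- `Dg(y) h` in closed form. [folklore] -/
theorem fderiv_weight_slice {a t : ℝ} (ht : t < a) (y h : EuclideanSpace ℝ (Fin 3)) :
    fderiv ℝ (fun y : EuclideanSpace ℝ (Fin 3) => (a - t) ^ 2 * Real.exp (-(‖y‖ ^ 2 / (4 * (a - t))))) y h =
      -(((a - t) ^ 2 * Real.exp (-(‖y‖ ^ 2 / (4 * (a - t))))) / (2 * (a - t))) * ⟪y, h⟫ := by
  rw [(hasFDerivAt_weight_slice ht y).fderiv, smul_apply, innerSL_apply_apply, smul_eq_mul]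

/-- Laplacian of the gauge: `Δg = (|y|²/(4(a−t)²) − 3/(2(a−t))) g`. [folklore] -/
theorem laplacian_weight_slice {a t : ℝ} (ht : t < a) (y : EuclideanSpace ℝ (Fin 3)) :
    (Δ fun y : EuclideanSpace ℝ (Fin 3) => (a - t) ^ 2 * Real.exp (-(‖y‖ ^ 2 / (4 * (a - t))))) y =
      (‖y‖ ^ 2 / (4 * (a - t) ^ 2) - 3 / (2 * (a - t))) *
        ((a - t) ^ 2 * Real.exp (-(‖y‖ ^ 2 / (4 * (a - t))))) := by
  have hσ : 0 < a - t := sub_pos.2 ht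
  set b := EuclideanSpace.basisFun (Fin 3) ℝ
  set g : EuclideanSpace ℝ (Fin 3) → ℝ := fun y => (a - t) ^ 2 * Real.exp (-(‖y‖ ^ 2 / (4 * (a - t)))) with hgdef
  have hgd : Differentiable ℝ g := (contDiff_weight_slice a t).differentiable two_ne_zero
  -- first derivatives along the frame
  have h1 : ∀ i, (fun y => fderiv ℝ g y (b i)) = fun y => -(2 * (a - t))⁻¹ * (⟪y, b i⟫ * g y) := by
    intro i; funext y
    rw [hgdef, fderiv_weight_slice ht]
    ring
  rw [laplacian_eq_sum_fderiv_fderiv b (contDiff_weight_slice a t) y]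
  simp_rw [show (fun y => (a - t) ^ 2 * Real.exp (-(‖y‖ ^ 2 / (4 * (a - t))))) = g from rfl, h1]
  have h2 : ∀ i, fderiv ℝ (fun y => -(2 * (a - t))⁻¹ * (⟪y, b i⟫ * g y)) y (b i) =
      -(2 * (a - t))⁻¹ * (g y - ⟪y, b i⟫ * ⟪y, b i⟫ * g y / (2 * (a - t))) := by
    intro i
    have hA : DifferentiableAt ℝ (fun y : EuclideanSpace ℝ (Fin 3) => ⟪y, b i⟫) y :=
      differentiableAt_id.inner ℝ (differentiableAt_const _)
    have hAg : DifferentiableAt ℝ (fun y : EuclideanSpace ℝ (Fin 3) => ⟪y, b i⟫ * g y) y := hA.mul (hgd y)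
    rw [fderiv_const_mul hAg, smul_apply, smul_eq_mul, fderiv_fun_mul hA (hgd y)]
    simp only [smul_apply, smul_eq_mul, add_apply]
    rw [hgdef, fderiv_weight_slice ht]
    have hid : DifferentiableAt ℝ (fun z : EuclideanSpace ℝ (Fin 3) => z) y := differentiableAt_id
    rw [fderiv_inner_apply ℝ hid (differentiableAt_const _)]
    have hbi : ⟪b i, b i⟫ = (1 : ℝ) := by
      rw [real_inner_self_eq_norm_sq, b.orthonormal.1 i, one_pow]
    simp only [fderiv_fun_const, Pi.zero_apply, zero_apply, inner_zero_right, zero_add, fderiv_fun_id,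
      ContinuousLinearMap.coe_id', id_eq, hbi]
    ring
  simp_rw [h2]
  rw [← Finset.mul_sum, Finset.sum_sub_distrib, Finset.sum_const, Finset.card_univ, Fintype.card_fin]
  have hsum : ∑ i, ⟪y, b i⟫ * ⟪y, b i⟫ * g y / (2 * (a - t)) = ‖y‖ ^ 2 * g y / (2 * (a - t)) := by
    rw [← Finset.sum_div, ← Finset.sum_mul]
    congr 2
    rw [← real_inner_self_eq_norm_sq, ← b.sum_inner_mul_inner y y]
    exact Finset.sum_congr rfl fun i _ => by rw [real_inner_comm (b i) y]
  rw [hsum]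
  change _ = (‖y‖ ^ 2 / (4 * (a - t) ^ 2) - 3 / (2 * (a - t))) * g y
  simp only [nsmul_eq_mul, Nat.cast_ofNat]
  field_simp
  ring

/-- Time derivative of the gauge: `∂ₜg = −(2/(a−t) + |y|²/(4(a−t)²)) g`. [folklore] -/
theorem hasDerivAt_weight_time {a t : ℝ} (ht : t < a) (y : EuclideanSpace ℝ (Fin 3)) :
    HasDerivAt (fun t => (a - t) ^ 2 * Real.exp (-(‖y‖ ^ 2 / (4 * (a - t)))))
      (-(2 / (a - t) + ‖y‖ ^ 2 / (4 * (a - t) ^ 2)) *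
        ((a - t) ^ 2 * Real.exp (-(‖y‖ ^ 2 / (4 * (a - t)))))) t := by
  have hσ : 0 < a - t := sub_pos.2 ht
  have hs : HasDerivAt (fun t => a - t) (-1) t := by simpa using (hasDerivAt_id t).const_sub a
  have h1 : HasDerivAt (fun t => (a - t) ^ 2) (((2 : ℕ) : ℝ) * (a - t) ^ (2 - 1) * (-1)) t := hs.fun_pow 2
  have h2 : HasDerivAt (fun t => (a - t)⁻¹) (-(-1) / (a - t) ^ 2) t := hs.fun_inv hσ.ne'
  have h3 : HasDerivAt (fun t => -(‖y‖ ^ 2 / (4 * (a - t)))) (-(‖y‖ ^ 2 / 4) * (-(-1) / (a - t) ^ 2)) t := by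
    have h := h2.const_mul (-(‖y‖ ^ 2 / 4))
    have hfun : (fun s => -(‖y‖ ^ 2 / 4) * (a - s)⁻¹) = fun s => -(‖y‖ ^ 2 / (4 * (a - s))) := by
      funext s
      rw [div_eq_mul_inv (‖y‖ ^ 2) (4 * (a - s)), mul_inv]
      ring
    rw [hfun] at h
    exact h
  refine (h1.fun_mul h3.exp).congr_deriv ?_
  push_cast
  field_simp
  ring

/-! ### The gauged slice identity -/

/-- **Gauged slice identity.**  For a `C²` slice `f`, a vector `w ⊥ y` (tangency of the drift at `y`) and the
gauge slice `g = (a−τ)² e^{−|·|²/(4(a−τ))}`: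
`(Δf − Df·w) g + f ∂ₜg = Δ(fg) − D(fg)·(w − y/(a−τ)) − fg/(2(a−τ))` at `y`
(Leibniz for `Δ` and `D`, `Dg = −(g/(2(a−τ))) ⟪y, ·⟫`, `⟪y, w⟫ = 0`, and the gauge identity). [folklore] -/
theorem gauge_slice_identity {f : EuclideanSpace ℝ (Fin 3) → ℝ} (hf : ContDiff ℝ 2 f) {a τ : ℝ} (hτ : τ < a)
    (y w : EuclideanSpace ℝ (Fin 3)) (hw : ⟪w, y⟫ = 0) {g : EuclideanSpace ℝ (Fin 3) → ℝ}
    (hg : g = fun z => (a - τ) ^ 2 * Real.exp (-(‖z‖ ^ 2 / (4 * (a - τ))))) :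
    ((Δ f) y - fderiv ℝ f y w) * g y + f y * (-(2 / (a - τ) + ‖y‖ ^ 2 / (4 * (a - τ) ^ 2)) * g y) =
      (Δ fun z => f z * g z) y - fderiv ℝ (fun z => f z * g z) y (w - (1 / (a - τ)) • y)
        - 1 / (2 * (a - τ)) * (f y * g y) := by
  have hσ : 0 < a - τ := sub_pos.2 hτ
  set b := EuclideanSpace.basisFun (Fin 3) ℝ
  have hg2 : ContDiff ℝ 2 g := by rw [hg]; exact contDiff_weight_slice a τ
  have hgd : Differentiable ℝ g := hg2.differentiable two_ne_zero
  have hfd : Differentiable ℝ f := hf.differentiable two_ne_zero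
  have hfg : ∀ z h, fderiv ℝ g z h = -(g z / (2 * (a - τ))) * ⟪z, h⟫ := by
    intro z h
    rw [hg]
    exact fderiv_weight_slice hτ z h
  have hΔg : (Δ g) y = (‖y‖ ^ 2 / (4 * (a - τ) ^ 2) - 3 / (2 * (a - τ))) * g y := by
    rw [hg]
    exact laplacian_weight_slice hτ y
  -- the cross term of the Leibniz rule for `Δ`
  have hrepr : fderiv ℝ f y y = ∑ i, ⟪b i, y⟫ * fderiv ℝ f y (b i) := by
    calc fderiv ℝ f y y = fderiv ℝ f y (∑ i, ⟪b i, y⟫ • b i) := by rw [b.sum_repr' y]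
      _ = ∑ i, ⟪b i, y⟫ * fderiv ℝ f y (b i) := by simp [map_sum, map_smul, smul_eq_mul]
  have hcross : ∑ i, fderiv ℝ f y (b i) * fderiv ℝ g y (b i) = -(g y / (2 * (a - τ))) * fderiv ℝ f y y := by
    simp_rw [hfg]
    rw [hrepr, Finset.mul_sum]
    refine Finset.sum_congr rfl fun i _ => ?_
    rw [real_inner_comm (b i) y]
    ring
  -- the Leibniz rule for `D`
  have hprod : fderiv ℝ (fun z => f z * g z) y (w - (1 / (a - τ)) • y) =
      fderiv ℝ f y (w - (1 / (a - τ)) • y) * g y + f y * fderiv ℝ g y (w - (1 / (a - τ)) • y) := by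
    rw [fderiv_fun_mul (hfd y) (hgd y)]
    simp only [add_apply, smul_apply, smul_eq_mul]
    ring
  have hfw : fderiv ℝ f y (w - (1 / (a - τ)) • y) = fderiv ℝ f y w - 1 / (a - τ) * fderiv ℝ f y y := by
    rw [map_sub, map_smul, smul_eq_mul]
  have hgw : fderiv ℝ g y (w - (1 / (a - τ)) • y) = g y / (2 * (a - τ)) * (‖y‖ ^ 2 / (a - τ)) := by
    rw [hfg, inner_sub_right, inner_smul_right, real_inner_comm w y, hw, real_inner_self_eq_norm_sq]
    field_simp
    ring
  rw [laplacian_mul_eq b hf hg2 y, hcross, hprod, hfw, hgw, hΔg]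
  field_simp
  ring

/-- `r e^{−r²/(8S)} ≤ √(2S)` for `r ≥ 0`, `S > 0` (AM–GM after `e^{−x} ≤ 1/(1+x)`). [folklore] -/
theorem mul_exp_neg_sq_le {r S : ℝ} (hr : 0 ≤ r) (hS : 0 < S) :
    r * Real.exp (-(r ^ 2 / (8 * S))) ≤ Real.sqrt (2 * S) := by
  set q : ℝ := Real.sqrt (2 * S) with hq
  have hq0 : 0 < q := Real.sqrt_pos.2 (by positivity)
  have hq2 : q ^ 2 = 2 * S := Real.sq_sqrt (by positivity)
  have hx : 0 ≤ r ^ 2 / (8 * S) := by positivity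
  have hexp : Real.exp (-(r ^ 2 / (8 * S))) ≤ 1 / (1 + r ^ 2 / (8 * S)) := by
    rw [Real.exp_neg, ← one_div]
    apply one_div_le_one_div_of_le (by positivity)
    linarith [Real.add_one_le_exp (r ^ 2 / (8 * S))]
  have hkey : r ≤ q * (1 + r ^ 2 / (8 * S)) := by
    have h8 : (8 : ℝ) * S = 4 * q ^ 2 := by rw [hq2]; ring
    rw [h8]
    have : q * (1 + r ^ 2 / (4 * q ^ 2)) = q + r ^ 2 / (4 * q) := by
      field_simp
    rw [this]
    have h4q : 0 < 4 * q := by positivity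
    rw [← sub_nonneg]
    have : q + r ^ 2 / (4 * q) - r = (r - 2 * q) ^ 2 / (4 * q) := by
      field_simp
      ring
    rw [this]
    positivity
  calc r * Real.exp (-(r ^ 2 / (8 * S))) ≤ r * (1 / (1 + r ^ 2 / (8 * S))) :=
        mul_le_mul_of_nonneg_left hexp hr
    _ = r / (1 + r ^ 2 / (8 * S)) := by ring
    _ ≤ q := by
        rw [div_le_iff₀ (by positivity)]
        exact hkey

variable {χ : ℝ → EuclideanSpace ℝ (Fin 3) → ℝ} {v : ℝ → EuclideanSpace ℝ (Fin 3) → EuclideanSpace ℝ (Fin 3)}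

/-- **FAR-PAST WASHOUT BOUND.**  `χ` jointly smooth on `(−∞,0) × ℝ³`, `∂ₜχ = Δχ − Dχ·v` classically with a
sphere-tangential drift `v`, `|χ(t,y)| ≤ C′|y|/(−t)`; then for `t₀ < 0`, `y₀` and `S > −t₀`,
`|χ(t₀,y₀)| (S−t₀)² e^{−|y₀|²/(4(S−t₀))} ≤ 4C′S√(2S)` (Friedman's weak maximum principle for the Gaussian gauge
`ζ = χ·(S−t)²e^{−|y|²/(4(S−t))}` on `[−S, t₀]`, see the module docstring).
[cite: Friedman1964, Ch. 2 §4 Lemma 5; folklore] -/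
theorem abs_mul_weight_le (hχ : IsSmoothSpaceTimeOn (Iio (0 : ℝ)) χ)
    (hχeq : ∀ t < (0 : ℝ), ∀ y, HasDerivAt (fun s => χ s y) ((Δ (χ t)) y - fderiv ℝ (χ t) y (v t y)) t)
    (htan : ∀ t < (0 : ℝ), ∀ y, ⟪v t y, y⟫ = 0) {C' : ℝ} (hC' : 0 ≤ C')
    (hgrow : ∀ t < (0 : ℝ), ∀ y, |χ t y| ≤ C' * ‖y‖ / (-t))
    {t₀ : ℝ} (ht₀ : t₀ < 0) (y₀ : EuclideanSpace ℝ (Fin 3)) {S : ℝ} (hS : -t₀ < S) :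
    |χ t₀ y₀| * ((S - t₀) ^ 2 * Real.exp (-(‖y₀‖ ^ 2 / (4 * (S - t₀))))) ≤ 4 * C' * S * Real.sqrt (2 * S) := by
  have hS0 : 0 < S := by linarith
  -- shifted time `τ = t + S ∈ [0, T']`, `T' = t₀ + S`; gauge parameter `a = 2S`
  set T' : ℝ := t₀ + S with hT'
  have hT'0 : 0 < T' := by linarith
  have hT'S : T' < S := by linarith
  set ζ : ℝ → EuclideanSpace ℝ (Fin 3) → ℝ :=
    fun τ y => χ (τ - S) y * ((2 * S - τ) ^ 2 * Real.exp (-(‖y‖ ^ 2 / (4 * (2 * S - τ))))) with hζ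
  set U : ℝ → EuclideanSpace ℝ (Fin 3) → EuclideanSpace ℝ (Fin 3) :=
    fun τ y => v (τ - S) y - (1 / (2 * S - τ)) • y with hU
  -- ### joint smoothness of the gauge product on `[0, T'] ⊆ (−∞, S)`
  have hshift : IsSmoothSpaceTimeOn (Iio S) fun τ y => χ (τ - S) y := by
    have hφ : ContDiff ℝ ∞ fun z : ℝ × EuclideanSpace ℝ (Fin 3) => (z.1 - S, z.2) :=
      (contDiff_fst.sub contDiff_const).prodMk contDiff_snd
    have hmaps : MapsTo (fun z : ℝ × EuclideanSpace ℝ (Fin 3) => (z.1 - S, z.2)) (Iio S ×ˢ univ)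
        (Iio (0 : ℝ) ×ˢ univ) := by
      intro z hz
      refine mem_prod.2 ⟨?_, mem_univ _⟩
      have h1 : z.1 < S := (mem_prod.1 hz).1
      show z.1 - S < 0
      linarith
    exact hχ.comp hφ.contDiffOn hmaps
  have hζs : IsSmoothSpaceTimeOn (Icc 0 T') ζ := by
    have h1 : IsSmoothSpaceTimeOn (Iio S) ζ :=
      hshift.mul ((isSmoothSpaceTimeOn_weight (2 * S)).mono (Iio_subset_Iio (by linarith)))
    exact h1.mono fun τ hτ => lt_of_le_of_lt hτ.2 hT'S
  -- ### the gauged equation: `ζ ∂ₜζ ≤ ζ (Δζ − U·∇ζ)` on `[0, T']`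
  have hle : ∀ τ ∈ Icc 0 T', ∀ y, ⟪ζ τ y, timeDerivWithin (Icc 0 T') ζ τ y⟫ ≤
      ⟪ζ τ y, (1 : ℝ) • (Δ (ζ τ)) y - convect (U τ) (ζ τ) y⟫ := by
    intro τ hτ y
    have ht : τ - S < 0 := by linarith [hτ.2]
    have hτa : τ < 2 * S := by linarith [hτ.2]
    have hσ : 0 < 2 * S - τ := by linarith
    -- the time derivative of the gauge product
    have hD₁ : HasDerivAt (fun τ' => χ (τ' - S) y)
        ((Δ (χ (τ - S))) y - fderiv ℝ (χ (τ - S)) y (v (τ - S) y)) τ :=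
      HasDerivAt.comp_sub_const τ S (hχeq (τ - S) ht y)
    have hD := hD₁.fun_mul (hasDerivAt_weight_time hτa y)
    have hder : timeDerivWithin (Icc 0 T') ζ τ y =
        ((Δ (χ (τ - S))) y - fderiv ℝ (χ (τ - S)) y (v (τ - S) y)) *
            ((2 * S - τ) ^ 2 * Real.exp (-(‖y‖ ^ 2 / (4 * (2 * S - τ))))) +
          χ (τ - S) y * (-(2 / (2 * S - τ) + ‖y‖ ^ 2 / (4 * (2 * S - τ) ^ 2)) *
            ((2 * S - τ) ^ 2 * Real.exp (-(‖y‖ ^ 2 / (4 * (2 * S - τ)))))) := by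
      rw [timeDerivWithin_apply]
      exact hD.hasDerivWithinAt.derivWithin (uniqueDiffOn_Icc hT'0 τ hτ)
    -- the slice identity
    have hf2 : ContDiff ℝ 2 (χ (τ - S)) := (hχ.contDiff_slice ht).of_le (by norm_cast)
    have hid := gauge_slice_identity hf2 hτa y (v (τ - S) y) (htan (τ - S) ht y) (g := fun z =>
      (2 * S - τ) ^ 2 * Real.exp (-(‖z‖ ^ 2 / (4 * (2 * S - τ))))) rfl
    -- assemble
    have hζτ : ζ τ = fun z => χ (τ - S) z * ((2 * S - τ) ^ 2 * Real.exp (-(‖z‖ ^ 2 / (4 * (2 * S - τ))))) := rfl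
    rw [hder, hid, one_smul, convect_apply, hζτ]
    simp only [RCLike.inner_apply, conj_trivial, hU]
    have hsq : 0 ≤ 1 / (2 * (2 * S - τ)) *
        (χ (τ - S) y * ((2 * S - τ) ^ 2 * Real.exp (-(‖y‖ ^ 2 / (4 * (2 * S - τ)))))) ^ 2 := by positivity
    nlinarith [hsq]
  -- ### decay at spatial infinity, uniformly on `[0, T']`
  have hbound : ∀ τ ∈ Icc 0 T', ∀ y, |ζ τ y| ≤
      C' * ‖y‖ / (-t₀) * ((2 * S) ^ 2 * Real.exp (-(‖y‖ ^ 2 / (8 * S)))) := by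
    intro τ hτ y
    have ht : τ - S < 0 := by linarith [hτ.2]
    have hσ : 0 < 2 * S - τ := by linarith [hτ.2]
    have hσ' : 2 * S - τ ≤ 2 * S := by linarith [hτ.1]
    have hw0 : 0 ≤ (2 * S - τ) ^ 2 * Real.exp (-(‖y‖ ^ 2 / (4 * (2 * S - τ)))) := by positivity
    rw [hζ, abs_mul, abs_of_nonneg hw0]
    have h1 : |χ (τ - S) y| ≤ C' * ‖y‖ / (-t₀) := by
      refine (hgrow (τ - S) ht y).trans ?_
      have : -t₀ ≤ -(τ - S) := by linarith [hτ.2]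
      exact div_le_div_of_nonneg_left (by positivity) (by linarith) this
    have hsq_le : (2 * S - τ) ^ 2 ≤ (2 * S) ^ 2 := pow_le_pow_left₀ hσ.le hσ' 2
    have hexp_le : Real.exp (-(‖y‖ ^ 2 / (4 * (2 * S - τ)))) ≤ Real.exp (-(‖y‖ ^ 2 / (8 * S))) := by
      apply Real.exp_le_exp.2
      apply neg_le_neg
      exact div_le_div_of_nonneg_left (by positivity) (by positivity) (by linarith)
    have h2 : (2 * S - τ) ^ 2 * Real.exp (-(‖y‖ ^ 2 / (4 * (2 * S - τ)))) ≤
        (2 * S) ^ 2 * Real.exp (-(‖y‖ ^ 2 / (8 * S))) :=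
      mul_le_mul hsq_le hexp_le (by positivity) (by positivity)
    exact mul_le_mul h1 h2 hw0 (div_nonneg (mul_nonneg hC' (norm_nonneg _)) (neg_nonneg.2 ht₀.le))
  have hunif : ∀ η : ℝ, 0 < η → ∃ R : ℝ, ∀ τ ∈ Icc 0 T', ∀ y : EuclideanSpace ℝ (Fin 3),
      R ≤ ‖y‖ → ‖ζ τ y‖ ≤ η := by
    intro η hη
    refine ⟨32 * C' * S ^ 3 / ((-t₀) * η) + 1, fun τ hτ y hy => ?_⟩
    have hm : 0 < -t₀ := neg_pos.2 ht₀
    have hy0 : 0 < ‖y‖ := by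
      have : 0 ≤ 32 * C' * S ^ 3 / ((-t₀) * η) := by positivity
      linarith
    rw [Real.norm_eq_abs]
    refine (hbound τ hτ y).trans ?_
    have hexp : Real.exp (-(‖y‖ ^ 2 / (8 * S))) ≤ 1 / (‖y‖ ^ 2 / (8 * S)) := by
      rw [Real.exp_neg, ← one_div]
      apply one_div_le_one_div_of_le (by positivity)
      linarith [Real.add_one_le_exp (‖y‖ ^ 2 / (8 * S))]
    calc C' * ‖y‖ / (-t₀) * ((2 * S) ^ 2 * Real.exp (-(‖y‖ ^ 2 / (8 * S))))
        ≤ C' * ‖y‖ / (-t₀) * ((2 * S) ^ 2 * (1 / (‖y‖ ^ 2 / (8 * S)))) := by gcongr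
      _ = 32 * C' * S ^ 3 / ((-t₀) * ‖y‖) := by
          field_simp
          ring
      _ ≤ η := by
          rw [div_le_iff₀ (by positivity)]
          have hR : 32 * C' * S ^ 3 / ((-t₀) * η) ≤ ‖y‖ := by linarith
          have := (div_le_iff₀ (by positivity : 0 < (-t₀) * η)).1 hR
          nlinarith [this, hη, hm]
  -- ### the initial bound at `τ = 0` (i.e. `t = −S`)
  have hM : ∀ y, ‖ζ 0 y‖ ≤ 4 * C' * S * Real.sqrt (2 * S) := by
    intro y
    rw [Real.norm_eq_abs, hζ]
    simp only [zero_sub, sub_zero]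
    have hw0 : 0 ≤ (2 * S) ^ 2 * Real.exp (-(‖y‖ ^ 2 / (4 * (2 * S)))) := by positivity
    rw [abs_mul, abs_of_nonneg hw0]
    have h1 : |χ (-S) y| ≤ C' * ‖y‖ / S := by
      have := hgrow (-S) (by linarith) y
      rwa [neg_neg] at this
    have h2 := mul_exp_neg_sq_le (norm_nonneg y) hS0
    calc |χ (-S) y| * ((2 * S) ^ 2 * Real.exp (-(‖y‖ ^ 2 / (4 * (2 * S)))))
        ≤ C' * ‖y‖ / S * ((2 * S) ^ 2 * Real.exp (-(‖y‖ ^ 2 / (4 * (2 * S))))) :=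
          mul_le_mul_of_nonneg_right h1 hw0
      _ = 4 * C' * S * (‖y‖ * Real.exp (-(‖y‖ ^ 2 / (8 * S)))) := by
          rw [show (4 : ℝ) * (2 * S) = 8 * S by ring]
          field_simp
          ring
      _ ≤ 4 * C' * S * Real.sqrt (2 * S) := by gcongr
  -- ### Friedman's weak maximum principle
  have hmax := norm_le_of_inner_timeDeriv_le (κ := 1) zero_le_one hζs hle hunif hM T'
    ⟨hT'0.le, le_rfl⟩ y₀
  rw [Real.norm_eq_abs, hζ] at hmax
  simp only at hmax
  have e1 : T' - S = t₀ := by rw [hT']; ring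
  have e2 : 2 * S - T' = S - t₀ := by rw [hT']; ring
  have hw0 : 0 ≤ (S - t₀) ^ 2 * Real.exp (-(‖y₀‖ ^ 2 / (4 * (S - t₀)))) := by positivity
  rw [e1, e2, abs_mul, abs_of_nonneg hw0] at hmax
  exact hmax

end Summit.NavierStokesRegularity.NavierStokesRegularity.Theorems.ImplosionDoorPassiveRadialVorticityWashout

end
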